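import Mathlib.Analysis.SpecialFunctions.Integrability.Basic
import Mathlib.Analysis.SpecialFunctions.Integrals.Basic
import Mathlib.Analysis.SpecialFunctions.Pow.Real
import Mathlib.MeasureTheory.Integral.Bochner.Set
import HarnessLib

/-!
# Barrier: a SUPERLINEAR weakly-singular Volterra inequality yields NO a-priori bound in terms of the
# forcing alone — the «key proposition» pattern `w < f + b₁∫₀ᵗ w²(t−τ)^{−μ} ⇒ ‖w‖_{L²} < √2‖f‖_{L²}`

Barrier catalogue entry for `NavierStokesRegularity` (D-0021), METHOD LEVEL, everything PROVED (Mathlib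
measure theory; explicit two-level step profiles).

A recurring scheme (cell `ns-claims`, row C42: Bazarbekov, arXiv:2002.05360v1; T4 family «integral-equation
/ a-priori estimate») rewrites the (forced, Dirichlet) Navier–Stokes problem as a Volterra system for
`w = u_t − ρΔu + ∇p`, derives from Green-function bounds the scalar inequality
**(3,4)** `w(t) < f(t) + b₁ ∫₀ᵗ w²(τ)(t − τ)^{−μ} dτ` (`μ ∈ [5/8,3/4)`, `w, f ≥ 0` the `L₂(Ω)`-sizes)
[cite: Bazarbekov2020, Lemma 3.2 (3,4) l.653–658 p.10], and then asserts the «key proposition»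
**Theorem 3.1**: «For all functions `w(t) ∈ L₂(0,T)` satisfying the inequality (3,4) the following estimate
holds: `‖w‖_{L₂(0,T)} < √2·‖f‖_{L₂(0,T)}`. This estimate does not depends on the number `b₁`»
[cite: Bazarbekov2020, Theorem 3.1 (3,5) l.714–719 p.11], feeding a Leray–Schauder existence argument.

This file proves that NO estimate of that shape can follow from (3,4) — for ANY constant in place of `√2`,
any `μ ∈ [0,1)`, any `b₁ > 0`, any `T > 0`:

* `ineq34_scale`: (3,4) is COVARIANT under `(w, f, b₁) ↦ (λw, λf, b₁/λ)`, `λ > 0` — so «independent of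
  `b₁`» is the same as «independent of the size of `f`», i.e. a claim uniform over a superlinear family;
* `exists_ineq34_norm_ratio_gt`: for every `C` there are non-negative, bounded, measurable `w, f` on `(0,T]`
  (explicitly: `f ≡ A`, `w = A` on `(0,T/2]`, `w = λA` on `(T/2,T]`, `λ = 2|C| + 2`, `A = λT^μ/(b₁T/2)`)
  satisfying the STRICT inequality (3,4) at EVERY `t ∈ (0,T]` and yet `‖w‖_{L²(0,T)} > C‖f‖_{L²(0,T)}`:
  the quadratic memory term `b₁∫₀ᵗ w²(t−τ)^{−μ}` accumulated on `(0,T/2]` pays for an arbitrarily large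
  later jump once `A` is large — superlinearity, nothing else. The paper's own Remark 3-1 records the
  germ of this («(3.2) does not exclude functions of the type `t/(T−t)`») [cite: Bazarbekov2020, Remark 3-1 l.628–641 p.9].

Honest neighbours (evasions): the LINEAR weakly-singular Grönwall inequality `w ≤ f + b∫₀ᵗ(t−τ)^{β−1}w`
DOES bound `w` by `f` with a constant depending on `(b, β, T)` [cite: Henry1981, Lemma 7.1.1] (tree:
`Literature.Analysis.FluidPDE.fractional_gronwall`, kernel exponent `1/2`); the quadratic inequality bounds
`w` for SHORT time / SMALL data only — PROVED here as `lt_two_mul_of_ineq34_of_small`: if `w ≥ 0` is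
continuous on `[0,T]`, `w ≤ F + b₁∫₀ᵗw²(t−τ)^{−μ}` and `4b₁FT^{1−μ} < 1−μ`, then `w < 2F` on `[0,T]`
(no first crossing). That is the local theory, which is exactly what a global large-data claim must go beyond.

## References

* A. Bazarbekov, arXiv:2002.05360v1 [math.GM] (2020), Lemma 3.2 (3,4) p.10, Theorem 3.1 (3,5) p.11,
  Remark 3-1 p.9. [`Bazarbekov2020`]
* D. Henry, *Geometric Theory of Semilinear Parabolic Equations*, LNM 840 (1981), Lemma 7.1.1
  (singular Grönwall lemma). [`Henry1981`]

WHAT THIS IS NOT: not a claim about NS regularity or blow-up; not a claim about any author beyond the typed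
locator.
-/

noncomputable section

open MeasureTheory Set Real
open scoped ENNReal

namespace Literature.Barriers.NavierStokesRegularity

namespace SuperlinearVolterra

/-! ## The inequality and its scaling covariance -/

/-- **Scaling covariance of (3,4).** If `w(t) < f(t) + b₁∫₀ᵗ w²(τ)(t−τ)^{−μ}dτ` on `(0,T]`, then for every
`λ > 0` the triple `(λw, λf, b₁/λ)` satisfies the same inequality. Hence a bound `‖w‖ ≤ C‖f‖` with `C`
«independent of `b₁`» would be a bound uniform over the whole superlinear family — the shape that
`exists_ineq34_norm_ratio_gt` refutes. [cite: Bazarbekov2020, Lemma 3.2 (3,4) l.653–658 p.10 and Theorem 3.1 l.714–719 p.11] -/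
theorem ineq34_scale {μ b₁ T : ℝ} {w f : ℝ → ℝ}
    (h : ∀ t ∈ Ioc 0 T, w t < f t + b₁ * ∫ τ in Ioo 0 t, w τ ^ 2 * (t - τ) ^ (-μ))
    {lam : ℝ} (hlam : 0 < lam) :
    ∀ t ∈ Ioc 0 T, lam * w t < lam * f t +
      b₁ / lam * ∫ τ in Ioo 0 t, (lam * w τ) ^ 2 * (t - τ) ^ (-μ) := by
  intro t ht
  have h1 := h t ht
  have hint : ∫ τ in Ioo 0 t, (lam * w τ) ^ 2 * (t - τ) ^ (-μ) =
      lam ^ 2 * ∫ τ in Ioo 0 t, w τ ^ 2 * (t - τ) ^ (-μ) := by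
    rw [← integral_const_mul]
    refine integral_congr_ae (ae_of_all _ fun τ => ?_)
    ring
  rw [hint]
  have : b₁ / lam * (lam ^ 2 * ∫ τ in Ioo 0 t, w τ ^ 2 * (t - τ) ^ (-μ)) =
      lam * (b₁ * ∫ τ in Ioo 0 t, w τ ^ 2 * (t - τ) ^ (-μ)) := by
    field_simp
  rw [this, ← mul_add]
  exact mul_lt_mul_of_pos_left h1 hlam

/-! ## Kernel bookkeeping -/

/-- The weakly singular kernel `τ ↦ (t − τ)^{−μ}` is integrable on `(0,t)` for `μ < 1`. [folklore] -/
private theorem kernel_integrableOn {μ : ℝ} (hμ1 : μ < 1) (t : ℝ) :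
    IntegrableOn (fun τ : ℝ => (t - τ) ^ (-μ)) (Ioo 0 t) volume := by
  have h : IntervalIntegrable (fun x : ℝ => x ^ (-μ)) volume 0 t :=
    intervalIntegral.intervalIntegrable_rpow' (by linarith)
  have h2 := h.comp_sub_left t
  simp only [sub_zero, sub_self] at h2
  -- `h2 : IntervalIntegrable (fun x => (t - x) ^ (-μ)) volume t 0`
  have h3 := h2.symm
  rcases le_or_gt 0 t with ht | ht
  · rw [intervalIntegrable_iff_integrableOn_Ioc_of_le ht] at h3
    exact h3.mono_set Ioo_subset_Ioc_self
  · rw [Ioo_eq_empty (by simp [ht.le.not_gt])]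
    exact integrableOn_empty

/-- On `(0,t)` the kernel dominates its value at the left end: `t^{−μ} ≤ (t − τ)^{−μ}` (`μ ≥ 0`). [folklore] -/
private theorem kernel_lower {μ t τ : ℝ} (hμ0 : 0 ≤ μ) (hτ : τ ∈ Ioo 0 t) :
    t ^ (-μ) ≤ (t - τ) ^ (-μ) :=
  Real.rpow_le_rpow_of_nonpos (by linarith [hτ.1, hτ.2]) (by linarith [hτ.1]) (by linarith)

/-! ## The two-level profile -/

/-- The two-level step profile `w = A` on `(−∞, s]`, `w = λA` on `(s, ∞)` is measurable
(no definition is introduced: the profile is the explicit `fun τ => if τ ≤ s then A else lam * A`). [folklore] -/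
private theorem stepProfile_measurable (A lam s : ℝ) :
    Measurable (fun τ : ℝ => if τ ≤ s then A else lam * A) :=
  Measurable.ite measurableSet_Iic measurable_const measurable_const

/-- Value of the profile before the jump. [folklore] -/
private theorem stepProfile_of_le {A lam s τ : ℝ} (h : τ ≤ s) : (if τ ≤ s then A else lam * A) = A := by
  simp [h]

/-- Value of the profile after the jump. [folklore] -/
private theorem stepProfile_of_gt {A lam s τ : ℝ} (h : s < τ) : (if τ ≤ s then A else lam * A) = lam * A := by
  simp [not_le.2 h]

/-- The profile is non-negative. [folklore] -/
private theorem stepProfile_nonneg {A lam s : ℝ} (hA : 0 ≤ A) (hlam : 0 ≤ lam) (τ : ℝ) :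
    0 ≤ (if τ ≤ s then A else lam * A) := by
  split_ifs
  · exact hA
  · exact mul_nonneg hlam hA

/-- The profile is bounded by its upper level `λA` (`λ ≥ 1`). [folklore] -/
private theorem stepProfile_le {A lam s : ℝ} (hA : 0 ≤ A) (hlam : 1 ≤ lam) (τ : ℝ) :
    (if τ ≤ s then A else lam * A) ≤ lam * A := by
  split_ifs
  · exact le_mul_of_one_le_left hA hlam
  · exact le_rfl

/-- The squared profile is at least `A²` (`λ ≥ 1`). [folklore] -/
private theorem stepProfile_sq_ge {A lam s : ℝ} (hA : 0 ≤ A) (hlam : 1 ≤ lam) (τ : ℝ) :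
    A ^ 2 ≤ (if τ ≤ s then A else lam * A) ^ 2 := by
  have h0 : A ≤ (if τ ≤ s then A else lam * A) := by
    split_ifs
    · exact le_rfl
    · exact le_mul_of_one_le_left hA hlam
  exact pow_le_pow_left₀ hA h0 2

/-- The memory integrand `w²(t−τ)^{−μ}` of the profile is integrable on `(0,t)`. [folklore] -/
private theorem memory_integrableOn {μ : ℝ} (hμ1 : μ < 1) {A lam s : ℝ} (hA : 0 ≤ A) (hlam : 1 ≤ lam)
    (t : ℝ) :
    IntegrableOn (fun τ : ℝ => (if τ ≤ s then A else lam * A) ^ 2 * (t - τ) ^ (-μ)) (Ioo 0 t) volume := by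
  refine Integrable.bdd_mul (c := (lam * A) ^ 2) (kernel_integrableOn hμ1 t) ?_ ?_
  · exact ((stepProfile_measurable A lam s).pow_const 2).aestronglyMeasurable
  · refine ae_of_all _ fun τ => ?_
    rw [Real.norm_eq_abs, abs_of_nonneg (sq_nonneg _)]
    exact pow_le_pow_left₀ (stepProfile_nonneg hA (zero_le_one.trans hlam) τ) (stepProfile_le hA hlam τ) 2

/-- Lower bound for the memory term: for `0 < s ≤ t`,
`A² · t^{−μ} · s ≤ ∫_{(0,t)} w²(t−τ)^{−μ} dτ`. [folklore] -/
private theorem memory_lower {μ : ℝ} (hμ0 : 0 ≤ μ) (hμ1 : μ < 1) {A lam s t : ℝ} (hA : 0 ≤ A)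
    (hlam : 1 ≤ lam) (hs : 0 < s) (hst : s ≤ t) {s' : ℝ} :
    A ^ 2 * t ^ (-μ) * s ≤ ∫ τ in Ioo 0 t, (if τ ≤ s' then A else lam * A) ^ 2 * (t - τ) ^ (-μ) := by
  have ht : 0 < t := hs.trans_le hst
  -- restrict to `(0,s)` and bound the integrand below by the constant `A² t^{−μ}`
  have hsub : Ioo 0 s ⊆ Ioo 0 t := Ioo_subset_Ioo le_rfl hst
  have hnn : ∀ τ ∈ Ioo 0 t, 0 ≤ (if τ ≤ s' then A else lam * A) ^ 2 * (t - τ) ^ (-μ) := fun τ hτ =>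
    mul_nonneg (sq_nonneg _) (Real.rpow_nonneg (by linarith [hτ.2]) _)
  have h1 : ∫ τ in Ioo 0 s, (if τ ≤ s' then A else lam * A) ^ 2 * (t - τ) ^ (-μ) ≤
      ∫ τ in Ioo 0 t, (if τ ≤ s' then A else lam * A) ^ 2 * (t - τ) ^ (-μ) :=
    setIntegral_mono_set (memory_integrableOn hμ1 hA hlam t)
      ((ae_restrict_iff' measurableSet_Ioo).2 (ae_of_all _ hnn)) (ae_of_all _ hsub)
  have h2 : ∫ τ in Ioo 0 s, A ^ 2 * t ^ (-μ) ≤ ∫ τ in Ioo 0 s, (if τ ≤ s' then A else lam * A) ^ 2 * (t - τ) ^ (-μ) := by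
    refine setIntegral_mono_on (integrableOn_const (by simp)) ((memory_integrableOn hμ1 hA hlam t).mono_set hsub)
      measurableSet_Ioo fun τ hτ => ?_
    exact mul_le_mul (stepProfile_sq_ge hA hlam τ) (kernel_lower hμ0 (hsub hτ)) (Real.rpow_nonneg ht.le _)
      (sq_nonneg _)
  have h3 : ∫ τ in Ioo 0 s, A ^ 2 * t ^ (-μ) = A ^ 2 * t ^ (-μ) * s := by
    rw [setIntegral_const, Real.volume_real_Ioo_of_le hs.le, sub_zero, smul_eq_mul]
    ring
  linarith

/-! ## The barrier -/

/-- **BARRIER: no a-priori bound `‖w‖_{L²(0,T)} ≤ C‖f‖_{L²(0,T)}` follows from the superlinear Volterra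
inequality (3,4) — for ANY `C`, any `μ ∈ [0,1)`, `b₁ > 0`, `T > 0`.** There are non-negative, bounded,
measurable `w, f` (the constant force `f ≡ A` and the two-level profile `w = A` on `(0,T/2]`, `w = λA` on
`(T/2,T]`, with `λ = 2|C| + 2`, `A = λT^μ/(b₁·(T/2))`) such that the STRICT inequality
`w(t) < f(t) + b₁∫₀ᵗ w²(τ)(t−τ)^{−μ}dτ` holds at every `t ∈ (0,T]`, every memory integral is finite, and
`C·‖f‖_{L²(0,T)} < ‖w‖_{L²(0,T)}` (norms as `√∫_{(0,T)}(·)²`). In particular Theorem 3.1 of the source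
(`C = √2`) is false as displayed, for every `b₁` — consistent with the kernel kill of the typed step
(`Summit.….Theorems.Bazarbekov2020.not_Step2_Theorem31`, typist-4 / refuter-6, cell `ns-claims` C42).

BARRIER (structured block, D-0021):
- technique_class: volterra-reformulation green-function-kernel weakly-singular-gronwall superlinear-integral-inequality a-priori-estimate-independent-of-nonlinearity leray-schauder-from-apriori-bound — cell `ns-claims` class T4 «integral-equation / a-priori estimate» [cite: Bazarbekov2020, Theorem 3.1 l.714–719 p.11]
- blocks: for NavierStokesRegularity (regularity/existence side, any domain), every scheme whose GLOBAL, LARGE-DATA bound is read off a scalar inequality `w ≤ f + b∫₀ᵗ K(t−τ)Φ(w(τ))dτ` with `Φ` SUPERLINEAR (here `Φ(w) = w²`, `K(s) = s^{−μ}`) and no further input (no smallness, no continuation/bootstrap structure, no sign/energy identity): such an inequality is satisfied by profiles with `‖w‖/‖f‖` arbitrarily large, so the asserted bound — and anything uniform in `b` or in the size of `f` (`ineq34_scale`) — cannot be a consequence of it; the Leray–Schauder step that consumes the bound is then unsupported [cite: Bazarbekov2020, proof of Theorem 2.1 l.1170–1216 p.19–20]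
- because: explicit two-level witnesses (this theorem): on `(0,T/2]` the inequality holds trivially (`w = f = A`, memory term `> 0`), on `(T/2,T]` the memory accumulated on `(0,T/2]` is `≥ b₁A²T^{−μ}(T/2) = λA > (λ−1)A`, which pays for the jump to `λA`; `‖w‖² ≥ λ²A²T/2 > C²A²T = C²‖f‖²` since `λ² > 2C²`; all functions bounded and measurable, the kernel integrable (`μ < 1`)
- evasions_known: (a) LINEAR weakly-singular Grönwall (Henry): `w ≤ f + b∫₀ᵗ(t−τ)^{β−1}w` gives `w ≤ f + θ∫E'_β(θ(t−s))f(s)ds`, a genuine bound with constant depending on `(b, β, T)` [cite: Henry1981, Lemma 7.1.1]; (b) the quadratic inequality DOES bound continuous `w` for short time / small data (bootstrap while `b₁T^{1−μ}·sup f ≲ 1−μ`) — the local theory; (c) coercive identities (energy equality, maximum principles) bound solutions because they are identities for SOLUTIONS, not inequalities satisfied by arbitrary functions — a bound «for all functions satisfying (3,4)» (the source's own grain, l.645–650) cannot borrow them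
- scope_caveats: (i) a statement about the INEQUALITY, at the source's printed grain «for all functions w ∈ L₂(0,T) satisfying (3,4)»; it does not say that solutions of the forced Dirichlet problem are unbounded (that is the open problem), only that (3,4) cannot be the reason they are bounded; (ii) kernel exponent `μ ∈ [0,1)` (the source uses `[5/8,3/4)`); other superlinear `Φ` and other integrable kernels behave the same way but are not formalised; (iii) strict «<» as printed; the witnesses are step functions (bounded, measurable), not continuous — continuity can be arranged by smoothing the jump but is not formalised; (iv) norms are `√∫_{(0,T)}(·)²` (Bochner set integrals over `Ioo 0 T`)
- status: established (proved here; Mathlib)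
[cite: Bazarbekov2020, Theorem 3.1 (3,5) l.714–719 p.11] -/
theorem exists_ineq34_norm_ratio_gt {μ : ℝ} (hμ0 : 0 ≤ μ) (hμ1 : μ < 1) {b₁ T : ℝ} (hb : 0 < b₁)
    (hT : 0 < T) (C : ℝ) :
    ∃ w f : ℝ → ℝ, Measurable w ∧ Measurable f ∧ (∀ t, 0 ≤ w t) ∧ (∀ t, 0 ≤ f t) ∧
      (∃ M : ℝ, ∀ t, w t ≤ M ∧ f t ≤ M) ∧
      (∀ t ∈ Ioc 0 T, IntegrableOn (fun τ : ℝ => w τ ^ 2 * (t - τ) ^ (-μ)) (Ioo 0 t) volume) ∧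
      (∀ t ∈ Ioc 0 T, w t < f t + b₁ * ∫ τ in Ioo 0 t, w τ ^ 2 * (t - τ) ^ (-μ)) ∧
      C * Real.sqrt (∫ t in Ioo 0 T, f t ^ 2) < Real.sqrt (∫ t in Ioo 0 T, w t ^ 2) := by
  -- parameters
  set lam : ℝ := 2 * |C| + 2 with hlam_def
  have hlam1 : 1 ≤ lam := by rw [hlam_def]; linarith [abs_nonneg C]
  have hlam0 : 0 < lam := by linarith
  set s : ℝ := T / 2 with hs_def
  have hs : 0 < s := by rw [hs_def]; linarith
  have hsT : s ≤ T := by rw [hs_def]; linarith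
  set A : ℝ := lam * T ^ μ / (b₁ * s) with hA_def
  have hTμ : 0 < T ^ μ := Real.rpow_pos_of_pos hT μ
  have hA : 0 < A := by
    rw [hA_def]
    exact div_pos (mul_pos hlam0 hTμ) (mul_pos hb hs)
  -- the key identity `b₁ A T^{-μ} s = lam`
  have hkey : b₁ * A * T ^ (-μ) * s = lam := by
    rw [hA_def, Real.rpow_neg hT.le]
    field_simp
  refine ⟨(fun τ : ℝ => if τ ≤ s then A else lam * A), fun _ => A, stepProfile_measurable A lam s, measurable_const,
    stepProfile_nonneg hA.le hlam0.le, fun _ => hA.le, ⟨lam * A, fun t => ⟨stepProfile_le hA.le hlam1 t,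
      le_mul_of_one_le_left hA.le hlam1⟩⟩,
    fun t _ => memory_integrableOn hμ1 hA.le hlam1 t, ?_, ?_⟩
  · -- the strict inequality on `(0,T]`
    intro t ht
    show (if t ≤ s then A else lam * A) < A + b₁ * ∫ τ in Ioo 0 t, (if τ ≤ s then A else lam * A) ^ 2 * (t - τ) ^ (-μ)
    by_cases hts : t ≤ s
    · -- early times: `w t = A = f t`, memory term `> 0`
      rw [stepProfile_of_le hts]
      have hmem : A ^ 2 * t ^ (-μ) * t ≤ ∫ τ in Ioo 0 t, (if τ ≤ s then A else lam * A) ^ 2 * (t - τ) ^ (-μ) :=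
        memory_lower hμ0 hμ1 hA.le hlam1 ht.1 le_rfl
      have hpos : 0 < A ^ 2 * t ^ (-μ) * t :=
        mul_pos (mul_pos (pow_pos hA 2) (Real.rpow_pos_of_pos ht.1 (-μ))) ht.1
      nlinarith [mul_pos hb (hpos.trans_le hmem)]
    · -- late times: the memory accumulated on `(0,s]` pays for the jump
      push Not at hts
      rw [stepProfile_of_gt hts]
      have hmem : A ^ 2 * t ^ (-μ) * s ≤ ∫ τ in Ioo 0 t, (if τ ≤ s then A else lam * A) ^ 2 * (t - τ) ^ (-μ) :=
        memory_lower hμ0 hμ1 hA.le hlam1 hs hts.le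
      -- `t^{-μ} ≥ T^{-μ}`
      have htT : T ^ (-μ) ≤ t ^ (-μ) :=
        Real.rpow_le_rpow_of_nonpos ht.1 ht.2 (by linarith)
      have h1 : b₁ * (A ^ 2 * T ^ (-μ) * s) ≤ b₁ * (A ^ 2 * t ^ (-μ) * s) := by
        apply mul_le_mul_of_nonneg_left _ hb.le
        exact mul_le_mul_of_nonneg_right (mul_le_mul_of_nonneg_left htT (sq_nonneg A)) hs.le
      have h2 : b₁ * (A ^ 2 * T ^ (-μ) * s) = lam * A := by
        calc b₁ * (A ^ 2 * T ^ (-μ) * s) = (b₁ * A * T ^ (-μ) * s) * A := by ring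
          _ = lam * A := by rw [hkey]
      have h3 : lam * A ≤ b₁ * ∫ τ in Ioo 0 t, (if τ ≤ s then A else lam * A) ^ 2 * (t - τ) ^ (-μ) :=
        calc lam * A = b₁ * (A ^ 2 * T ^ (-μ) * s) := h2.symm
          _ ≤ b₁ * (A ^ 2 * t ^ (-μ) * s) := h1
          _ ≤ b₁ * ∫ τ in Ioo 0 t, (if τ ≤ s then A else lam * A) ^ 2 * (t - τ) ^ (-μ) :=
              mul_le_mul_of_nonneg_left hmem hb.le
      linarith
  · -- the norm ratio
    have hf : ∫ t in Ioo 0 T, A ^ 2 = A ^ 2 * T := by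
      rw [setIntegral_const, Real.volume_real_Ioo_of_le hT.le, sub_zero, smul_eq_mul, mul_comm]
    have hw_int : IntegrableOn (fun t : ℝ => (if t ≤ s then A else lam * A) ^ 2) (Ioo 0 T) volume := by
      refine Measure.integrableOn_of_bounded (M := (lam * A) ^ 2) (by simp [Real.volume_Ioo])
        ((stepProfile_measurable A lam s).pow_const 2).aestronglyMeasurable (ae_of_all _ fun τ => ?_)
      rw [Real.norm_eq_abs, abs_of_nonneg (sq_nonneg _)]
      exact pow_le_pow_left₀ (stepProfile_nonneg hA.le hlam0.le τ) (stepProfile_le hA.le hlam1 τ) 2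
    -- lower bound for `∫ w²`: restrict to `(s,T)` where `w = lam A`
    have hwlow : (lam * A) ^ 2 * (T - s) ≤ ∫ t in Ioo 0 T, (if t ≤ s then A else lam * A) ^ 2 := by
      have hsub : Ioo s T ⊆ Ioo 0 T := Ioo_subset_Ioo hs.le le_rfl
      have h1 : ∫ t in Ioo s T, (if t ≤ s then A else lam * A) ^ 2 ≤ ∫ t in Ioo 0 T, (if t ≤ s then A else lam * A) ^ 2 :=
        setIntegral_mono_set hw_int ((ae_restrict_iff' measurableSet_Ioo).2 (ae_of_all _ fun τ _ =>
          sq_nonneg _)) (ae_of_all _ hsub)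
      have h2 : ∫ t in Ioo s T, (if t ≤ s then A else lam * A) ^ 2 = ∫ t in Ioo s T, (lam * A) ^ 2 :=
        setIntegral_congr_fun measurableSet_Ioo fun τ hτ => by rw [stepProfile_of_gt hτ.1]
      have h3 : ∫ t in Ioo s T, (lam * A) ^ 2 = (lam * A) ^ 2 * (T - s) := by
        rw [setIntegral_const, Real.volume_real_Ioo_of_le hsT, smul_eq_mul, mul_comm]
      linarith
    have hTs : T - s = T / 2 := by rw [hs_def]; ring
    rw [hTs] at hwlow
    -- compare squares
    have hC2 : C ^ 2 * (A ^ 2 * T) < (lam * A) ^ 2 * (T / 2) := by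
      have hl : 2 * C ^ 2 < lam ^ 2 := by
        rw [hlam_def]
        nlinarith [abs_nonneg C, sq_abs C]
      have hAT : 0 < A ^ 2 * T := by positivity
      nlinarith
    have hlhs : C * Real.sqrt (∫ t in Ioo 0 T, A ^ 2) ≤ |C| * Real.sqrt (A ^ 2 * T) := by
      rw [hf]; exact mul_le_mul_of_nonneg_right (le_abs_self C) (Real.sqrt_nonneg _)
    have habs : |C| * Real.sqrt (A ^ 2 * T) = Real.sqrt (C ^ 2 * (A ^ 2 * T)) := by
      rw [Real.sqrt_mul (sq_nonneg C), Real.sqrt_sq_eq_abs]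
    refine lt_of_le_of_lt (hlhs.trans_eq habs) ?_
    calc Real.sqrt (C ^ 2 * (A ^ 2 * T)) < Real.sqrt ((lam * A) ^ 2 * (T / 2)) :=
          Real.sqrt_lt_sqrt (by positivity) hC2
      _ ≤ Real.sqrt (∫ t in Ioo 0 T, (if t ≤ s then A else lam * A) ^ 2) := Real.sqrt_le_sqrt hwlow

/-! ## The honest local statement (evasion (b) made kernel): short-time / small-data boundedness -/

/-- The total mass of the kernel: `∫_{(0,t)} (t−τ)^{−μ} dτ = t^{1−μ}/(1−μ)` (`μ < 1`, `t ≥ 0`). [folklore] -/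
private theorem setIntegral_kernel_eq {μ : ℝ} (hμ1 : μ < 1) {t : ℝ} (ht : 0 ≤ t) :
    ∫ τ in Ioo 0 t, (t - τ) ^ (-μ) = t ^ (1 - μ) / (1 - μ) := by
  rw [← integral_Ioc_eq_integral_Ioo, ← intervalIntegral.integral_of_le ht,
    intervalIntegral.integral_comp_sub_left (fun x : ℝ => x ^ (-μ)) t]
  simp only [sub_self, sub_zero]
  rw [integral_rpow (Or.inl (by linarith : (-1:ℝ) < -μ))]
  have h1 : -μ + 1 = 1 - μ := by ring
  rw [h1, Real.zero_rpow (by linarith : (1:ℝ) - μ ≠ 0), sub_zero]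

/-- **The honest content of (3,4): a LOCAL (short-time / small-data) bound.** If `w ≥ 0` is continuous on
`[0,T]` and `w(t) ≤ F + b₁∫₀ᵗ w²(τ)(t−τ)^{−μ}dτ` for `t ∈ [0,T]` (at `t = 0`: `w(0) ≤ F`), and the
SMALLNESS condition `4 b₁ F T^{1−μ} < 1 − μ` holds, then `w < 2F` on `[0,T]` (no first crossing of the
level `2F`: at the first time `t₁` with `w(t₁) ≥ 2F`, the memory is at most `4b₁F²t₁^{1−μ}/(1−μ) < F`).
This is the bootstrap behind LOCAL solvability results obtained from such inequalities — the time of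
validity shrinks like `(b₁F)^{−1/(1−μ)}` with the size of the data, which is exactly why no global,
size-independent bound (`exists_ineq34_norm_ratio_gt`) can come out of (3,4).
[cite: Henry1981, Lemma 7.1.1 (singular Grönwall; the quadratic variant bootstraps only locally)] -/
theorem lt_two_mul_of_ineq34_of_small {μ : ℝ} (hμ1 : μ < 1) {b₁ F T : ℝ} (hb : 0 < b₁)
    (hF : 0 < F) (hsmall : 4 * b₁ * F * T ^ (1 - μ) < 1 - μ)
    {w : ℝ → ℝ} (hw : ContinuousOn w (Icc 0 T)) (hw0 : ∀ t ∈ Icc 0 T, 0 ≤ w t)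
    (hineq : ∀ t ∈ Icc 0 T, w t ≤ F + b₁ * ∫ τ in Ioo 0 t, w τ ^ 2 * (t - τ) ^ (-μ)) :
    ∀ t ∈ Icc 0 T, w t < 2 * F := by
  by_contra hcon
  push Not at hcon
  obtain ⟨t₀, ht₀, hbad⟩ := hcon
  -- the closed set of «bad» times and its infimum
  set B : Set ℝ := Icc 0 T ∩ w ⁻¹' Ici (2 * F) with hBdef
  have hBclosed : IsClosed B := hw.preimage_isClosed_of_isClosed isClosed_Icc isClosed_Ici
  have hBne : B.Nonempty := ⟨t₀, ht₀, hbad⟩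
  have hBbdd : BddBelow B := ⟨0, fun t ht => ht.1.1⟩
  set t₁ : ℝ := sInf B with ht₁def
  have ht₁B : t₁ ∈ B := hBclosed.csInf_mem hBne hBbdd
  have ht₁I : t₁ ∈ Icc 0 T := ht₁B.1
  have hwt₁ : 2 * F ≤ w t₁ := ht₁B.2
  -- before `t₁`, `w < 2F`
  have hbefore : ∀ τ ∈ Ioo 0 t₁, w τ ^ 2 ≤ (2 * F) ^ 2 := by
    intro τ hτ
    have hτI : τ ∈ Icc 0 T := ⟨hτ.1.le, hτ.2.le.trans ht₁I.2⟩
    have hlt : w τ < 2 * F := by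
      by_contra hge
      push Not at hge
      have hτB : τ ∈ B := ⟨hτI, hge⟩
      exact absurd (csInf_le hBbdd hτB) (not_le.2 hτ.2)
    exact pow_le_pow_left₀ (hw0 τ hτI) hlt.le 2
  -- `w` is bounded on `[0,T]`, so the memory integrand is integrable
  obtain ⟨M, hM⟩ := isCompact_Icc.exists_bound_of_continuousOn hw
  have hsub : Ioo 0 t₁ ⊆ Icc 0 T := fun τ hτ => ⟨hτ.1.le, hτ.2.le.trans ht₁I.2⟩
  have hwmeas : AEStronglyMeasurable (fun τ => w τ ^ 2) (volume.restrict (Ioo 0 t₁)) :=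
    ((hw.mono hsub).pow 2).aestronglyMeasurable measurableSet_Ioo
  have hint : IntegrableOn (fun τ => w τ ^ 2 * (t₁ - τ) ^ (-μ)) (Ioo 0 t₁) volume := by
    refine Integrable.bdd_mul (c := M ^ 2) (kernel_integrableOn hμ1 t₁) hwmeas ?_
    refine (ae_restrict_iff' measurableSet_Ioo).2 (ae_of_all _ fun τ hτ => ?_)
    rw [Real.norm_eq_abs, abs_of_nonneg (sq_nonneg _)]
    have h1 : |w τ| ≤ M := by simpa [Real.norm_eq_abs] using hM τ (hsub hτ)
    have h2 : w τ ^ 2 = |w τ| ^ 2 := (sq_abs _).symm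
    rw [h2]
    exact pow_le_pow_left₀ (abs_nonneg _) h1 2
  -- the memory at `t₁` is at most `(2F)² t₁^{1−μ}/(1−μ) ≤ 4F² T^{1−μ}/(1−μ)`
  have hmem : ∫ τ in Ioo 0 t₁, w τ ^ 2 * (t₁ - τ) ^ (-μ) ≤ (2 * F) ^ 2 * (T ^ (1 - μ) / (1 - μ)) := by
    have h1 : ∫ τ in Ioo 0 t₁, w τ ^ 2 * (t₁ - τ) ^ (-μ) ≤ ∫ τ in Ioo 0 t₁, (2 * F) ^ 2 * (t₁ - τ) ^ (-μ) :=
      setIntegral_mono_on hint ((kernel_integrableOn hμ1 t₁).const_mul _) measurableSet_Ioo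
        fun τ hτ => mul_le_mul_of_nonneg_right (hbefore τ hτ) (Real.rpow_nonneg (by linarith [hτ.2]) _)
    have h2 : ∫ τ in Ioo 0 t₁, (2 * F) ^ 2 * (t₁ - τ) ^ (-μ) = (2 * F) ^ 2 * (t₁ ^ (1 - μ) / (1 - μ)) := by
      rw [integral_const_mul, setIntegral_kernel_eq hμ1 ht₁I.1]
    have h3 : t₁ ^ (1 - μ) ≤ T ^ (1 - μ) := Real.rpow_le_rpow ht₁I.1 ht₁I.2 (by linarith)
    have h4 : (2 * F) ^ 2 * (t₁ ^ (1 - μ) / (1 - μ)) ≤ (2 * F) ^ 2 * (T ^ (1 - μ) / (1 - μ)) :=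
      mul_le_mul_of_nonneg_left (div_le_div_of_nonneg_right h3 (by linarith)) (sq_nonneg _)
    linarith
  -- smallness: `b₁ · 4F² T^{1−μ}/(1−μ) < F`
  have hsmall' : b₁ * ((2 * F) ^ 2 * (T ^ (1 - μ) / (1 - μ))) < F := by
    have h1μ : 0 < 1 - μ := by linarith
    rw [show b₁ * ((2 * F) ^ 2 * (T ^ (1 - μ) / (1 - μ))) = (4 * b₁ * F * T ^ (1 - μ)) * F / (1 - μ) by ring]
    rw [div_lt_iff₀ h1μ]
    nlinarith
  have := hineq t₁ ht₁I
  have hfin : w t₁ < 2 * F := by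
    have := mul_le_mul_of_nonneg_left hmem hb.le
    linarith
  linarith

end SuperlinearVolterra

end Literature.Barriers.NavierStokesRegularity

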